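import Summits.Ventures.PercRepro.RankLevelSetHallLevel

/-! # RankLevelSetHallLevelIndep — THE LEVEL-WISE LYM FORM ON INDEPENDENT SETS (LLI) AND ITS REDUCTION TO THE RANK-LEVEL FORM
(night-1 g23, attempt 2; dossier §35.1 and §35.9(d); a statement of record, NOT asserted)

At the tight layer `#E = p + q` the members are the independent `q`-sets with a basis as complement, and the rank-`t`
sets above a member `Z` are `Z ∪ X` (`X ⊆ E ∖ Z`) of rank `t`; the INDEPENDENT ones among them are exactly the
independent `t`-sets containing `Z` (`|S| = t = r(S)`). The form (LLI) counts only those: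

  (LLI)  C(p+q, t)·#𝒜 ≤ C(p+q, q)·#{S independent, #S = t, S ⊇ some Z ∈ 𝒜}   for every 𝒜 ⊆ members, q < t < p.

It is STRONGER than the rank-level form `LevelHallUpC025` (fewer sets on the right) and, at the tight layer,
census-clean: every matroid on ≤ 9 elements, every cell, every level (23 / 37 / 334 / 1,290 instances, exact max-flow,
0 violations; dossier §35.2), the model family `T_{q+k}(U_{q,F} ⊕ free)` on `q ≤ 30`, `k ≤ 9` (12,600 instances) and
the cells where Rule Q fails; above the tight layer it is FALSE (loops / parallel members, §35.1). Why it is the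
sharper target: on the model the exact level flows at `(q,k,m,s) = (11,9,1,8)` and `(7,10,4,9)` route EVERYTHING
through independent sets — the fat sets idle (§35.9(d)) — and on the model (LLI) at level `s = t − q` is a
RESTRICTED BOOLEAN LYM: a member of type `i = #(Z ∩ F) ∈ [m, q]` is adjacent to the set types `a = #(S ∩ F) ∈ [i, i+s]`,
exactly the Boolean pattern on the two-part ground set `F ∪ D`, with the member types `i < m` (not co-spanning) and the
set types `a > q` (dependent) removed; Hall's condition there reduces to the interval inequalities
`C(q+k,s)/C(q+s,s)·Σ_{i=i₁}^{i₂} C(q+m,i)·C(u+k,q−i) ≤ Σ_{a=i₁}^{min(i₂+s,q)} C(q+m,a)·C(u+k,q+s−a)` (`u = q − m`).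

This file types (LLI) as a `Prop` (`LevelHallUpIndepC025`, NOT asserted) and proves the reduction: (LLI) at a level
gives the rank-level inequality at that level (`levelHallUp_of_indepLevel`), hence `LevelHallUpC025` restricted to the
tight layer (`levelHallUp_tight_of_levelHallUpIndep`) and, through the tree, `HallUpC025` / `C025` there. The only
matroid fact used: an independent `t`-set has rank `t`. Every declaration has a docstring; imports: the cell's own
modules and Mathlib only. -/

namespace PercRepro

open Set Matroid Finset

variable {α : Type} {M : Matroid α} [M.Finite]

omit [M.Finite] in
/-- **The independent rank-`t` UP-neighbours of a family of members**: the `S ∈ upNbhd 𝒜` that are independent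
`t`-sets. At the tight layer these are the independent `t`-sets containing some member of `𝒜`. -/
def indepLevelNbhd (M : Matroid α) (p q t : ℕ) (𝒜 : Set (Set α)) : Set (Set α) :=
  {S ∈ upNbhd M p q 𝒜 | M.Indep S ∧ S.ncard = t}

omit [M.Finite] in
/-- **THE LEVEL-WISE LYM FORM ON INDEPENDENT SETS, (LLI)** (a `Prop`, NOT asserted): at the tight layer `#E = p + q`
of every finite matroid, every cell `q + 2 ≤ p`, every subfamily `𝒜` of members and every level `q < t < p`,
`C(p+q,t)·#𝒜 ≤ C(p+q,q)·#{S ∈ upNbhd 𝒜 : S independent, #S = t}`. -/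
def LevelHallUpIndepC025 : Prop :=
  ∀ {α : Type} (M : Matroid α) [M.Finite] (p q t : ℕ), M.E.ncard = p + q → q + 2 ≤ p → q < t → t < p →
    ∀ 𝒜 ⊆ cellMembers M p q,
      ((p + q).choose t : ℚ) * (𝒜.ncard : ℚ) ≤
        ((p + q).choose q : ℚ) * ((indepLevelNbhd M p q t 𝒜).ncard : ℚ)

/-- An independent `t`-set in the UP-neighbourhood is a rank-`t` UP-neighbour. -/
lemma indepLevelNbhd_subset (p q t : ℕ) (𝒜 : Set (Set α)) :
    indepLevelNbhd M p q t 𝒜 ⊆ {S ∈ upNbhd M p q 𝒜 | M.eRk S = (t : ℕ∞)} := by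
  intro S hS
  obtain ⟨hup, hind, hcard⟩ := hS
  refine ⟨hup, ?_⟩
  have hfin : S.Finite := M.ground_finite.subset hup.1
  rw [hind.eRk_eq_encard, hfin.encard_eq_coe_toFinset_card, ← Set.ncard_eq_toFinset_card S hfin, hcard]

/-- The rank-`t` UP-neighbours form a finite family (a subset of `Y`). -/
lemma levelNbhd_finite (p q t : ℕ) (𝒜 : Set (Set α)) :
    {S ∈ upNbhd M p q 𝒜 | M.eRk S = (t : ℕ∞)}.Finite :=
  (cellY_finite M p q).subset (fun _ hS => upNbhd_subset_cellY 𝒜 p q hS.1)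

/-- There are at least as many rank-`t` UP-neighbours as independent `t`-set UP-neighbours. -/
lemma ncard_indepLevelNbhd_le (p q t : ℕ) (𝒜 : Set (Set α)) :
    (indepLevelNbhd M p q t 𝒜).ncard ≤ {S ∈ upNbhd M p q 𝒜 | M.eRk S = (t : ℕ∞)}.ncard :=
  Set.ncard_le_ncard (indepLevelNbhd_subset p q t 𝒜) (levelNbhd_finite p q t 𝒜)

/-- **(LLI) at a level gives the rank-level inequality at that level**: if `C(p+q,t)·#𝒜 ≤ C(p+q,q)·#(independent
`t`-set UP-neighbours)` then `C(p+q,t)·#𝒜 ≤ C(p+q,q)·#(rank-`t` UP-neighbours)`. -/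
theorem levelHallUp_of_indepLevel (p q t : ℕ) (𝒜 : Set (Set α))
    (h : ((p + q).choose t : ℚ) * (𝒜.ncard : ℚ) ≤
      ((p + q).choose q : ℚ) * ((indepLevelNbhd M p q t 𝒜).ncard : ℚ)) :
    ((p + q).choose t : ℚ) * (𝒜.ncard : ℚ) ≤
      ((p + q).choose q : ℚ) * ({S ∈ upNbhd M p q 𝒜 | M.eRk S = (t : ℕ∞)}.ncard : ℚ) := by
  refine le_trans h (mul_le_mul_of_nonneg_left ?_ (by positivity))
  exact_mod_cast ncard_indepLevelNbhd_le p q t 𝒜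

/-- **(LLI) gives the level-wise form at the tight layer**: `LevelHallUpIndepC025` yields, for every finite matroid
with `#E = p + q`, every cell, every level and every `𝒜`, the inequality of `LevelHallUpC025`. -/
theorem levelHallUp_tight_of_levelHallUpIndep (h : LevelHallUpIndepC025) {p q t : ℕ} (hE : M.E.ncard = p + q)
    (hpq : q + 2 ≤ p) (hqt : q < t) (htp : t < p) (𝒜 : Set (Set α)) (h𝒜 : 𝒜 ⊆ cellMembers M p q) :
    ((p + q).choose t : ℚ) * (𝒜.ncard : ℚ) ≤
      ((p + q).choose q : ℚ) * ({S ∈ upNbhd M p q 𝒜 | M.eRk S = (t : ℕ∞)}.ncard : ℚ) :=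
  levelHallUp_of_indepLevel p q t 𝒜 (h M p q t hE hpq hqt htp 𝒜 h𝒜)

/-! ## CORRECTION (night-1 g23, attempt 2, 05:2xZ; dossier §35.12′)

The docstrings above say that on the model the Hall condition of the level form «reduces to the intervals of member
types» because every set type is adjacent to an interval of types. That inference is not valid in general: the interval
reduction of Hall's condition needs the vertices being matched (the member types) to have interval neighbourhoods, not
the set types; a union of two runs of types can have a smaller neighbourhood-to-size ratio than every interval. What is
true: the symmetrisation reduces Hall to unions of whole types (arbitrary subsets of `[0, u]`), and every interval
inequality is a NECESSARY condition. So `LLIModelIneq` (all intervals) is implied by (LLI) on the model, but the converse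
is an unproved claim (exact type max-flows over all type-unions find no non-interval union tighter than every interval
on `q ≤ 16`, `k ≤ 8`; kit j299494 extends the exact check to `q ≤ 80`, `k ≤ 12`). Nothing proved in this file depends on
the claim. -/

end PercRepro
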